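import Mathlib
import Summits.MatrixMultiplication.MatrixMultiplication.Theorems.SubgroupIdentityDesigns.Negative.Reversal

/-!
# A level-one identity design of volume 2200 in `GL₂(𝔽₁₁)` — the Borel family is not optimal
(positive instance for the crux `SubgroupIdentityDesigns`, stmt-MatrixMultiplication-14079, cell B2b-5, gen 8;
census report `run/shared/lean/b2b/levelgraded-cu/ORACLE-g8.md` §G8-2a)

The identity-design clause of the crux at `(m,k) = (2,1)` asks, for subgroups `H₁, H₂, H₃ ≤ GL₂(𝔽_p)` with the
subgroup triple-product property, for a level-one function `f = Σ_{rk M ≤ 1} c_M ψ(tr(M·))` with `f(1) = 1` and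
`f(abg) = 0` (`a ∈ H₁, b ∈ H₂, g ∈ H₃, abg ≠ 1`).  Inside a common BOREL subgroup of `GL₂(𝔽₁₁)` the best volume is
`|H₁||H₂||H₃| = 2000 = 2(p−1)³` (`ORACLE-g6.md`, `BorelToralCeiling.lean`); the exact non-Borel census (kit jobs
j066549, j066550, j075331) found certified designs of volume `2200 = 2p(p−1)²`.  This file KERNEL-CERTIFIES one
(`design_2115_4_5649`, support 37, denominator 11): `H₁ = ⟨[[0,1],[4,8]]⟩ ≅ C₁₀` (split torus), elements
`e₁ : Fin 10 → GL₂`; `H₂ = ⟨[[3,1],[3,8]]⟩ ≅ C₂` (a reflection, `det = −1`), elements `e₂`;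
`H₃ = {[[1,x],[0,t]]}` (order 110, the stabiliser of the vector `(1,0)`), cut out by `g₁₀ = 0, g₀₀ = 1` and
enumerated by `e₃ x t`; the design `f = (1/11) Σ_{i<37} a_i · [g·u_{j_i} = w_i]` (table `tbl`) is a rational
combination of fibre indicators, hence level one by `Reversal.fibreIndicator_mem_levelSet`.

`exists_levelOne_design_volume_2200`: `SubgroupTPP`, orders `10, 2, 110` (volume `2200 > 2000`), NO common
eigenvector (no common Borel), and the design clause of the crux literally.  The finite checks (closure, TPP over
the 2 200 products, the 2 199 vanishing values, `f(1) = 1`, no common eigenvector) are `native_decide` evaluations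
over `𝔽₁₁` quantified over index types `Fin n` (bounded `Finset` quantifiers crashed the farm evaluator, gen-8
`HANDOFF.md` item 15); the passage to the Fourier-side clause is the tree's level-one machinery.  The certificate was
also checked engine-free by `code/b2b-lgcu-borel-g8/verify_design.py` (18 such designs, `census/pass2200/`).
Consequence for the cell: `V*(2,1,11) ≥ 2200 > 2000`, `ε*(2,1,11)` improves `43.137 → 25.422` — a statement about
level one at `p = 11`: VALUE = kernel-certified instance of a decidable finite question, NOT summit progress; the
crux item (an asymptotic family statement) stays open.
-/

set_option linter.dupNamespace false

open scoped BigOperators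
open Summit.MatrixMultiplication.MatrixMultiplication.Theorems.LieRankDesigns.Negative
  (GLm Mat fourierFn RankSupp levelSet)
open Summit.MatrixMultiplication.MatrixMultiplication.Theorems.LieRankDesigns.LevelOfFixedVector
  (smul_mem_levelSet sum_mem_levelSet)
open Literature.Barriers.MatrixMultiplication (SubgroupTPP)

namespace Summit.MatrixMultiplication.MatrixMultiplication.Theorems.SubgroupIdentityDesigns.Negative

namespace PassV2200

/-- `11` is prime (instance for the level vocabulary at `p = 11`). -/
instance fact_prime_eleven : Fact (Nat.Prime 11) := ⟨by norm_num⟩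

/-! ## The three subgroups -/

/-- The unit of `GL₂(𝔽₁₁)` with matrix `[[a,b],[c,d]]` and the explicit inverse `(ad−bc)⁻¹·[[d,−b],[−c,a]]`
(the identity if `ad − bc = 0`).  Computable, so that `native_decide` can evaluate group products. -/
def mkGL (a b c d : ZMod 11) : GLm 11 2 :=
  if h : a * d - b * c = 0 then 1 else
    { val := !![a, b; c, d]
      inv := !![(a * d - b * c)⁻¹ * d, -((a * d - b * c)⁻¹ * b);
               -((a * d - b * c)⁻¹ * c), (a * d - b * c)⁻¹ * a]
      val_inv := by
        have hD : (a * d - b * c)⁻¹ * (a * d - b * c) = 1 := inv_mul_cancel₀ h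
        have h00 : a * ((a * d - b * c)⁻¹ * d) + b * -((a * d - b * c)⁻¹ * c) = 1 := by
          linear_combination hD
        have h01 : a * -((a * d - b * c)⁻¹ * b) + b * ((a * d - b * c)⁻¹ * a) = 0 := by ring
        have h10 : c * ((a * d - b * c)⁻¹ * d) + d * -((a * d - b * c)⁻¹ * c) = 0 := by ring
        have h11 : c * -((a * d - b * c)⁻¹ * b) + d * ((a * d - b * c)⁻¹ * a) = 1 := by
          linear_combination hD
        rw [Matrix.mul_fin_two, Matrix.one_fin_two, h00, h01, h10, h11]
      inv_val := by
        have hD : (a * d - b * c)⁻¹ * (a * d - b * c) = 1 := inv_mul_cancel₀ h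
        have h00 : (a * d - b * c)⁻¹ * d * a + -((a * d - b * c)⁻¹ * b) * c = 1 := by
          linear_combination hD
        have h01 : (a * d - b * c)⁻¹ * d * b + -((a * d - b * c)⁻¹ * b) * d = 0 := by ring
        have h10 : -((a * d - b * c)⁻¹ * c) * a + (a * d - b * c)⁻¹ * a * c = 0 := by ring
        have h11 : -((a * d - b * c)⁻¹ * c) * b + (a * d - b * c)⁻¹ * a * d = 1 := by
          linear_combination hD
        rw [Matrix.mul_fin_two, Matrix.one_fin_two, h00, h01, h10, h11] }

/-- The matrix of `mkGL a b c d` for `ad − bc ≠ 0`. -/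
theorem mkGL_val (a b c d : ZMod 11) (h : a * d - b * c ≠ 0) :
    ((mkGL a b c d : GLm 11 2) : Mat 11 2) = !![a, b; c, d] := by
  unfold mkGL
  rw [dif_neg h]

/-- The ten elements of `H₁ = ⟨[[0,1],[4,8]]⟩ ≅ C₁₀` (its successive powers), indexed. -/
def e₁ : Fin 10 → GLm 11 2 :=
  ![1, mkGL 0 1 4 8, mkGL 4 8 10 2, mkGL 10 2 8 4, mkGL 8 4 5 7, mkGL 5 7 6 6,
    mkGL 6 6 2 10, mkGL 2 10 7 5, mkGL 7 5 9 3, mkGL 9 3 1 0]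

/-- The two elements of `H₂ = ⟨[[3,1],[3,8]]⟩ ≅ C₂`, indexed. -/
def e₂ : Fin 2 → GLm 11 2 := ![1, mkGL 3 1 3 8]

/-- The elements `[[1,x],[0,t]]` of `H₃`, indexed by `x t : Fin 11` (used for `t ≠ 0`). -/
def e₃ (x t : Fin 11) : GLm 11 2 := mkGL 1 ((x : ℕ) : ZMod 11) 0 ((t : ℕ) : ZMod 11)

/-- The element set of `H₁`. -/
def S₁ : Finset (GLm 11 2) := Finset.univ.image e₁

/-- The element set of `H₂`. -/
def S₂ : Finset (GLm 11 2) := Finset.univ.image e₂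

/-- The element set of `H₃` (110 elements). -/
def S₃ : Finset (GLm 11 2) :=
  ((Finset.univ : Finset (Fin 11 × Fin 11)).filter fun q => (q.2 : ℕ) ≠ 0).image fun q => e₃ q.1 q.2

/-- Membership in `S₁`. -/
theorem mem_S₁ {a : GLm 11 2} : a ∈ S₁ ↔ ∃ i, e₁ i = a := by
  simp [S₁]

/-- Membership in `S₂`. -/
theorem mem_S₂ {a : GLm 11 2} : a ∈ S₂ ↔ ∃ i, e₂ i = a := by
  simp [S₂]

/-- Membership in `S₃`. -/
theorem mem_S₃ {a : GLm 11 2} : a ∈ S₃ ↔ ∃ x t : Fin 11, (t : ℕ) ≠ 0 ∧ e₃ x t = a := by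
  constructor
  · intro h
    obtain ⟨q, hq, rfl⟩ := Finset.mem_image.1 h
    exact ⟨q.1, q.2, (Finset.mem_filter.1 hq).2, rfl⟩
  · rintro ⟨x, t, ht, rfl⟩
    exact Finset.mem_image.2 ⟨(x, t), Finset.mem_filter.2 ⟨Finset.mem_univ _, ht⟩, rfl⟩

/-- A finite set of units containing `1` and closed under products and inverses, as a subgroup. -/
def subgroupOf (S : Finset (GLm 11 2)) (h1 : (1 : GLm 11 2) ∈ S) (hm : ∀ a ∈ S, ∀ b ∈ S, a * b ∈ S)
    (hi : ∀ a ∈ S, a⁻¹ ∈ S) : Subgroup (GLm 11 2) where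
  carrier := ↑S
  one_mem' := Finset.mem_coe.2 h1
  mul_mem' := fun {a b} ha hb => Finset.mem_coe.2 (hm a (Finset.mem_coe.1 ha) b (Finset.mem_coe.1 hb))
  inv_mem' := fun {a} ha => Finset.mem_coe.2 (hi a (Finset.mem_coe.1 ha))

/-- Membership in `subgroupOf S` is membership in `S`. -/
theorem mem_subgroupOf {S : Finset (GLm 11 2)} {h1 hm hi} {a : GLm 11 2} :
    a ∈ subgroupOf S h1 hm hi ↔ a ∈ S :=
  Finset.mem_coe

/-- `Nat.card (subgroupOf S) = S.card`. -/
theorem card_subgroupOf (S : Finset (GLm 11 2)) (h1 hm hi) : Nat.card (subgroupOf S h1 hm hi) = S.card := by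
  rw [← SetLike.coe_sort_coe,
    show ((subgroupOf S h1 hm hi : Subgroup (GLm 11 2)) : Set (GLm 11 2)) = ↑S from rfl,
    Nat.card_coe_set_eq, Set.ncard_coe_finset]

/-- Closure data of `S₁` (evaluated: 100 products, 10 inverses). -/
theorem S₁_facts : (1 : GLm 11 2) ∈ S₁ ∧ (∀ i j : Fin 10, e₁ i * e₁ j ∈ S₁) ∧ ∀ i : Fin 10, (e₁ i)⁻¹ ∈ S₁ := by
  native_decide

/-- Closure data of `S₂` (evaluated). -/
theorem S₂_facts : (1 : GLm 11 2) ∈ S₂ ∧ (∀ i j : Fin 2, e₂ i * e₂ j ∈ S₂) ∧ ∀ i : Fin 2, (e₂ i)⁻¹ ∈ S₂ := by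
  native_decide

/-- `H₁ ≅ C₁₀`. -/
def H₁ : Subgroup (GLm 11 2) :=
  subgroupOf S₁ S₁_facts.1
    (fun a ha b hb => by
      obtain ⟨i, rfl⟩ := mem_S₁.1 ha
      obtain ⟨j, rfl⟩ := mem_S₁.1 hb
      exact S₁_facts.2.1 i j)
    (fun a ha => by
      obtain ⟨i, rfl⟩ := mem_S₁.1 ha
      exact S₁_facts.2.2 i)

/-- `H₂ ≅ C₂`. -/
def H₂ : Subgroup (GLm 11 2) :=
  subgroupOf S₂ S₂_facts.1
    (fun a ha b hb => by
      obtain ⟨i, rfl⟩ := mem_S₂.1 ha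
      obtain ⟨j, rfl⟩ := mem_S₂.1 hb
      exact S₂_facts.2.1 i j)
    (fun a ha => by
      obtain ⟨i, rfl⟩ := mem_S₂.1 ha
      exact S₂_facts.2.2 i)

/-- `H₃ = {g : g₁₀ = 0, g₀₀ = 1}` = the matrices `[[1,x],[0,t]]`, the stabiliser of the vector `(1,0)` (order 110). -/
def H₃ : Subgroup (GLm 11 2) where
  carrier := {g | (g : Mat 11 2) 1 0 = 0 ∧ (g : Mat 11 2) 0 0 = 1}
  one_mem' := by
    simp
  mul_mem' := by
    intro a b ha hb
    simp only [Set.mem_setOf_eq, Units.val_mul, Matrix.mul_apply, Fin.sum_univ_two] at ha hb ⊢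
    refine ⟨?_, ?_⟩
    · rw [ha.1, hb.1]; ring
    · rw [ha.2, hb.2, hb.1]; ring
  inv_mem' := by
    intro a ha
    simp only [Set.mem_setOf_eq] at ha ⊢
    have h : ((a⁻¹ : GLm 11 2) : Mat 11 2) * (a : Mat 11 2) = 1 := by
      rw [← Units.val_mul, inv_mul_cancel, Units.val_one]
    have e00 := congr_fun (congr_fun h 0) 0
    have e10 := congr_fun (congr_fun h 1) 0
    simp only [Matrix.mul_apply, Fin.sum_univ_two, ha.1, ha.2, mul_one, mul_zero, add_zero,
      Matrix.one_apply] at e00 e10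
    simp only [if_true] at e00
    simp only [Fin.one_eq_zero_iff, OfNat.ofNat_ne_one, if_false] at e10
    exact ⟨e10, e00⟩

/-- Every `e₃ x t`, `t ≠ 0`, satisfies the two defining conditions of `H₃` (evaluated). -/
theorem S₃_shape : ∀ x t : Fin 11, (t : ℕ) ≠ 0 →
    ((e₃ x t : GLm 11 2) : Mat 11 2) 1 0 = 0 ∧ ((e₃ x t : GLm 11 2) : Mat 11 2) 0 0 = 1 := by
  native_decide

/-- `H₃` is enumerated by `S₃`. -/
theorem mem_H₃_iff (g : GLm 11 2) : g ∈ H₃ ↔ g ∈ S₃ := by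
  constructor
  · rintro ⟨h10, h00⟩
    have h11 : (g : Mat 11 2) 1 1 ≠ 0 := by
      intro h11
      have h : (g : Mat 11 2) * ((g⁻¹ : GLm 11 2) : Mat 11 2) = 1 := by
        rw [← Units.val_mul, mul_inv_cancel, Units.val_one]
      have e := congr_fun (congr_fun h 1) 1
      simp [Matrix.mul_apply, Fin.sum_univ_two, h10, h11] at e
    refine mem_S₃.2 ⟨⟨((g : Mat 11 2) 0 1).val, ZMod.val_lt _⟩, ⟨((g : Mat 11 2) 1 1).val, ZMod.val_lt _⟩,
      ?_, ?_⟩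
    · simpa [ZMod.val_eq_zero] using h11
    · apply Units.ext
      simp only [e₃, ZMod.natCast_zmod_val]
      rw [mkGL_val _ _ _ _ (by simpa using h11)]
      ext i j
      fin_cases i <;> fin_cases j <;> simp [h10, h00]
  · intro hg
    obtain ⟨x, t, ht, rfl⟩ := mem_S₃.1 hg
    exact S₃_shape x t ht

/-- `(H₃ : Set) = S₃`. -/
theorem coe_H₃ : (H₃ : Set (GLm 11 2)) = ↑S₃ :=
  Set.ext fun g => by rw [SetLike.mem_coe, Finset.mem_coe, mem_H₃_iff]

/-- The orders: `|S₁| = 10`, `|S₂| = 2`, `|S₃| = 110` (evaluated). -/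
theorem card_facts : S₁.card = 10 ∧ S₂.card = 2 ∧ S₃.card = 110 := by
  native_decide

/-- `|H₁| = 10`, `|H₂| = 2`, `|H₃| = 110`. -/
theorem card_H : Nat.card H₁ = 10 ∧ Nat.card H₂ = 2 ∧ Nat.card H₃ = 110 := by
  refine ⟨?_, ?_, ?_⟩
  · rw [H₁, card_subgroupOf]; exact card_facts.1
  · rw [H₂, card_subgroupOf]; exact card_facts.2.1
  · rw [← SetLike.coe_sort_coe, coe_H₃, Nat.card_coe_set_eq, Set.ncard_coe_finset]
    exact card_facts.2.2

/-- The subgroup triple-product property over the 2 200 products (evaluated). -/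
theorem tpp_fact : ∀ i : Fin 10, ∀ j : Fin 2, ∀ x t : Fin 11, (t : ℕ) ≠ 0 →
    e₁ i * e₂ j * e₃ x t = 1 → e₁ i = 1 ∧ e₂ j = 1 ∧ e₃ x t = 1 := by
  native_decide

/-- No nonzero vector of `𝔽₁₁²` is an eigenvector of all three of `[[0,1],[4,8]] ∈ H₁`, `[[3,1],[3,8]] ∈ H₂`,
`[[1,1],[0,1]] ∈ H₃`: the triple lies in no common Borel subgroup (evaluated: 120 vectors × 3 × 11 scalars). -/
theorem nonBorel_fact : ∀ v : Fin 2 → ZMod 11, v ≠ 0 →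
    (∀ t : ZMod 11, ((e₁ 1 : GLm 11 2) : Mat 11 2).mulVec v ≠ t • v) ∨
    (∀ t : ZMod 11, ((e₂ 1 : GLm 11 2) : Mat 11 2).mulVec v ≠ t • v) ∨
    (∀ t : ZMod 11, ((e₃ 1 1 : GLm 11 2) : Mat 11 2).mulVec v ≠ t • v) := by
  native_decide

/-! ## The design -/

/-- The standard line representatives `u_j = (j,1)` (`j < 11`) and `u_11 = (1,0)`. -/
def u (j : Fin 12) : Fin 2 → ZMod 11 := if (j : ℕ) < 11 then ![((j : ℕ) : ZMod 11), 1] else ![1, 0]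

/-- The certificate table: 37 weighted fibre indicators `(j, w, a)` ↦ `a · [g·u_j = w]` (kit j066550,
`design_2115_4_5649`, denominator 11). -/
def tbl : Array (Fin 12 × (Fin 2 → ZMod 11) × ℤ) :=
  #[(0, ![0, 1], 1),
    (0, ![3, 0], -1),
    (1, ![1, 1], 1),
    (1, ![4, 0], -1),
    (2, ![2, 1], 1),
    (2, ![5, 0], -1),
    (3, ![3, 1], 1),
    (3, ![6, 0], -1),
    (4, ![4, 1], 1),
    (4, ![7, 0], -1),
    (5, ![5, 1], 1),
    (5, ![8, 0], -1),
    (6, ![6, 1], 1),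
    (6, ![9, 0], -1),
    (7, ![0, 7], 1),
    (7, ![1, 3], 1),
    (7, ![2, 10], 1),
    (7, ![3, 6], 1),
    (7, ![4, 2], 1),
    (7, ![5, 9], 1),
    (7, ![6, 5], 1),
    (7, ![7, 1], 2),
    (7, ![8, 8], 1),
    (7, ![9, 4], 1),
    (8, ![8, 1], 1),
    (9, ![1, 0], -1),
    (9, ![9, 1], 1),
    (10, ![0, 8], -1),
    (10, ![1, 4], -1),
    (10, ![2, 0], -2),
    (10, ![3, 7], -1),
    (10, ![4, 3], -1),
    (10, ![5, 10], -1),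
    (10, ![6, 6], -1),
    (10, ![7, 2], -1),
    (10, ![8, 9], -1),
    (10, ![9, 5], -1)]

/-- Line index of the `i`-th table entry. -/
def lineOf (i : Fin 37) : Fin 12 := (tbl.getD i.1 (0, ![0, 0], 0)).1
/-- Target point of the `i`-th table entry. -/
def ptOf (i : Fin 37) : Fin 2 → ZMod 11 := (tbl.getD i.1 (0, ![0, 0], 0)).2.1
/-- Integer weight of the `i`-th table entry. -/
def coefOf (i : Fin 37) : ℤ := (tbl.getD i.1 (0, ![0, 0], 0)).2.2

/-- Boolean test `s·u_{j_i} = w_i` on the four entries of `s`. -/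
def hit (s₀₀ s₀₁ s₁₀ s₁₁ : ZMod 11) (i : Fin 37) : Bool :=
  decide (s₀₀ * u (lineOf i) 0 + s₀₁ * u (lineOf i) 1 = ptOf i 0) &&
    decide (s₁₀ * u (lineOf i) 0 + s₁₁ * u (lineOf i) 1 = ptOf i 1)

/-- The integer numerator of the design on the entries of `s`. -/
def Nent (s₀₀ s₀₁ s₁₀ s₁₁ : ZMod 11) : ℤ := ∑ i : Fin 37, if hit s₀₀ s₀₁ s₁₀ s₁₁ i then coefOf i else 0

/-- The integer numerator `N(s) = Σ_i a_i [s·u_{j_i} = w_i]` of the design. -/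
def N (s : Mat 11 2) : ℤ := Nent (s 0 0) (s 0 1) (s 1 0) (s 1 1)

/-- The design function `f = N/11` on `GL₂(𝔽₁₁)`, as a combination of fibre indicators. -/
noncomputable def f (g : GLm 11 2) : ℂ :=
  ∑ i : Fin 37, ((coefOf i : ℂ) / 11) * (if (g : Mat 11 2).mulVec (u (lineOf i)) = ptOf i then (1 : ℂ) else 0)

/-- `f` is a level-one function. -/
theorem f_mem_levelSet : f ∈ levelSet 11 2 1 := by
  refine sum_mem_levelSet (Finset.univ : Finset (Fin 37)) _ fun i _ => ?_
  have hi : (fun g : GLm 11 2 => if (g : Mat 11 2).mulVec (u (lineOf i)) = ptOf i then (1 : ℂ) else 0)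
      ∈ levelSet 11 2 1 := by
    convert Reversal.fibreIndicator_mem_levelSet (p := 11) (u (lineOf i)) (ptOf i)
  exact smul_mem_levelSet hi _

/-- The entrywise test agrees with `mulVec`. -/
theorem hit_iff (s : Mat 11 2) (i : Fin 37) :
    hit (s 0 0) (s 0 1) (s 1 0) (s 1 1) i = true ↔ s.mulVec (u (lineOf i)) = ptOf i := by
  simp only [hit, Bool.and_eq_true, decide_eq_true_eq]
  rw [funext_iff, Fin.forall_fin_two]
  simp [Matrix.mulVec, dotProduct, Fin.sum_univ_two]

/-- `f = N / 11`. -/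
theorem f_eq (g : GLm 11 2) : f g = ((N (g : Mat 11 2) : ℤ) : ℂ) / 11 := by
  unfold f N Nent
  push_cast
  rw [Finset.sum_div]
  refine Finset.sum_congr rfl fun i _ => ?_
  by_cases h : (g : Mat 11 2).mulVec (u (lineOf i)) = ptOf i
  · have h' : hit ((g : Mat 11 2) 0 0) ((g : Mat 11 2) 0 1) ((g : Mat 11 2) 1 0) ((g : Mat 11 2) 1 1) i =
        true := (hit_iff _ i).2 h
    rw [if_pos h, if_pos h']
    ring
  · have h' : ¬ (hit ((g : Mat 11 2) 0 0) ((g : Mat 11 2) 0 1) ((g : Mat 11 2) 1 0) ((g : Mat 11 2) 1 1) i =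
        true) := fun hh => h ((hit_iff _ i).1 hh)
    rw [if_neg h, if_neg h']
    simp

/-- The values of the design: `N(1) = 11` and `N(abg) = 0` for every non-trivial product (2 199 evaluations). -/
theorem value_facts : N 1 = 11 ∧ ∀ i : Fin 10, ∀ j : Fin 2, ∀ x t : Fin 11, (t : ℕ) ≠ 0 →
    e₁ i * e₂ j * e₃ x t ≠ 1 → N ((e₁ i * e₂ j * e₃ x t : GLm 11 2) : Mat 11 2) = 0 := by
  native_decide

/-- **A NON-BOREL LEVEL-ONE IDENTITY DESIGN OF VOLUME 2200 IN `GL₂(𝔽₁₁)`.**  There are subgroups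
`H₁, H₂, H₃ ≤ GL₂(𝔽₁₁)` of orders `10, 2, 110` (volume `2200 > 2000 =` the Borel optimum of ORACLE-g6) with the
subgroup triple-product property, lying in no common Borel subgroup (no common eigenvector), which satisfy the
identity-design clause of `SubgroupIdentityDesigns` at `(m, k, p) = (2, 1, 11)` literally. -/
theorem exists_levelOne_design_volume_2200 :
    ∃ H₁ H₂ H₃ : Subgroup (Matrix.GeneralLinearGroup (Fin 2) (ZMod 11)),
      SubgroupTPP H₁ H₂ H₃ ∧ Nat.card H₁ = 10 ∧ Nat.card H₂ = 2 ∧ Nat.card H₃ = 110 ∧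
      (∀ v : Fin 2 → ZMod 11, v ≠ 0 → ∃ h : Matrix.GeneralLinearGroup (Fin 2) (ZMod 11),
        (h ∈ H₁ ∨ h ∈ H₂ ∨ h ∈ H₃) ∧
          ∀ t : ZMod 11, (h : Matrix (Fin 2) (Fin 2) (ZMod 11)).mulVec v ≠ t • v) ∧
      ∃ c : Matrix (Fin 2) (Fin 2) (ZMod 11) → ℂ, (∀ M, 1 < M.rank → c M = 0) ∧
        (∑ M : Matrix (Fin 2) (Fin 2) (ZMod 11), c M * ZMod.stdAddChar (Matrix.trace
          (M * ((1 : Matrix.GeneralLinearGroup (Fin 2) (ZMod 11)) : Matrix (Fin 2) (Fin 2) (ZMod 11))))) = 1 ∧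
        ∀ a ∈ H₁, ∀ b ∈ H₂, ∀ g ∈ H₃, a * b * g ≠ 1 →
          (∑ M : Matrix (Fin 2) (Fin 2) (ZMod 11), c M * ZMod.stdAddChar (Matrix.trace
            (M * ((a * b * g : Matrix.GeneralLinearGroup (Fin 2) (ZMod 11)) :
              Matrix (Fin 2) (Fin 2) (ZMod 11))))) = 0 := by
  obtain ⟨c, hc, hcf⟩ := f_mem_levelSet
  refine ⟨H₁, H₂, H₃, ?_, card_H.1, card_H.2.1, card_H.2.2, ?_, c, hc, ?_, ?_⟩
  · intro a ha b hb g hg h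
    obtain ⟨i, rfl⟩ := mem_S₁.1 (mem_subgroupOf.1 ha)
    obtain ⟨j, rfl⟩ := mem_S₂.1 (mem_subgroupOf.1 hb)
    obtain ⟨x, t, ht, rfl⟩ := mem_S₃.1 ((mem_H₃_iff _).1 hg)
    exact tpp_fact i j x t ht h
  · intro v hv
    rcases nonBorel_fact v hv with h | h | h
    · exact ⟨_, Or.inl (mem_subgroupOf.2 (mem_S₁.2 ⟨1, rfl⟩)), h⟩
    · exact ⟨_, Or.inr (Or.inl (mem_subgroupOf.2 (mem_S₂.2 ⟨1, rfl⟩))), h⟩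
    · exact ⟨_, Or.inr (Or.inr ((mem_H₃_iff _).2 (mem_S₃.2 ⟨1, 1, by decide, rfl⟩))), h⟩
  · show fourierFn c 1 = 1
    rw [← hcf 1, f_eq, Units.val_one, value_facts.1]
    norm_num
  · intro a ha b hb g hg hne
    show fourierFn c (a * b * g) = 0
    obtain ⟨i, rfl⟩ := mem_S₁.1 (mem_subgroupOf.1 ha)
    obtain ⟨j, rfl⟩ := mem_S₂.1 (mem_subgroupOf.1 hb)
    obtain ⟨x, t, ht, rfl⟩ := mem_S₃.1 ((mem_H₃_iff _).1 hg)
    rw [← hcf _, f_eq, value_facts.2 i j x t ht hne]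
    simp

/-- The volume of the certified triple exceeds the Borel optimum `2000 = 2(p−1)³` of ORACLE-g6 / `BorelToralCeiling`:
`|H₁|·|H₂|·|H₃| = 2200`. -/
theorem volume_eq : Nat.card H₁ * Nat.card H₂ * Nat.card H₃ = 2200 ∧ 2000 < 2200 := by
  rw [card_H.1, card_H.2.1, card_H.2.2]; norm_num

end PassV2200

end Summit.MatrixMultiplication.MatrixMultiplication.Theorems.SubgroupIdentityDesigns.Negative
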